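import Summits.CriticalPhenomena.PercolationContinuityZ3.Theorems.PercNearOneGluingAdditiveGluingPairStepWinsDominate
import Summits.CriticalPhenomena.PercolationContinuityZ3.Theorems.PercNearOneGluingAdditiveGluingKnThm2GoodEvents
import HarnessLib

/-! # Crux `PercNearOneGluing.AdditiveGluing` (stmt-CriticalPhenomena-4576), line `peel`, stub `stub_toolHijackBHK` —
# tool N2 of the pair step: the hijack bound `Z(s) · Hij ≤ WIN(s) · Z_x(s)`

Support file (`--supports stmt-CriticalPhenomena-4576`, registered stub `stub_toolHijackBHK`); no definitions, no named facts.

`μ = prodBernoulli u` on the bond configurations of the complete weighted graph `Fin n`; `A` the relay set, `b ∈ A` the target,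
`a₀ ∈ A` the designated relay, `s ∉ A` the observer, `x ∉ A` a bystander; `C(s)` the open cluster of `s` and `{C(s) = W}` its
fibres; a vertex set `W` is DEAD if `s ∈ W` and `W ∩ A = ∅`.  With the dead-pocket mass (worst selection)
`Z(s) = Σ_{W dead} μ(C(s) = W) · min_{a ∈ A} μ(a ↔ b in Wᶜ)`, `Hij = μ(s ↔ b, a₀ ↮ s, x ↔ a₀)`, `WIN(s) = μ(s ↔ b, a₀ ↮ s)` and
`Z_x(s)` = `Z(s)` with the extra factor `μ(x ↔ a₀ in Wᶜ)` in each summand: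
* `stub_toolHijackBHK`: **`Z(s) · Hij ≤ WIN(s) · Z_x(s)`**.
Proof.  `N = {a₀ ↮ s}`.  (1) van den Berg–Häggström–Kahn 2006, eq. (2) (= Thm 1.4 for `1{b ∈ C_s}`, `1{x ∈ C_{a₀}}`):
`μ(N) μ(N, s↔b, x↔a₀) ≤ μ(N, s↔b) μ(N, x↔a₀)`.  (2) BHK Thm 1.3, antitone × antitone, for the cluster of `s` given `N`
(`offObs_bhk_anti_anti`) with `ζ(T) = 1{T ∩ A = ∅} min_A μ(· ↔ b in Tᶜ)` and `ψ(T) = μ(x ↔ a₀ in Tᶜ)`; its three fibre sums are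
`Z(s)`, `μ(N, x↔a₀)` (cluster Markov property `offObs_fibre_inter`: on `{C(s) = T} ⊆ N`, `x ↔ a₀` iff `x ↔ a₀ in Tᶜ`, an event of
the pairs off `T`) and `Z_x(s)`.  Chain `μ(N)·Z·Hij ≤ Z·μ(N,s↔b)·μ(N,x↔a₀) ≤ μ(N,s↔b)·μ(N)·Z_x` and cancel `μ(N)`.
[cite: VandenbergHaggstromKahn2005, eq. (2) (p. 2), Thm. 1.3 (p. 6), Thm. 1.4 (p. 7); KozmaNitzan2024, Lemma 1 (pp. 5–6), §3.2 pp. 12–14]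
-/

namespace Summit.CriticalPhenomena.PercolationContinuityZ3.Theorems

open MeasureTheory Set
open Literature.Probability.LatticeModels (prodBernoulli)
open Literature.Probability.Percolation (BondConfig openConn openConnIn openGraph openCluster)
open scoped BigOperators Classical
noncomputable section

section ToolHijackBHKAux

open Literature.Probability.Percolation

variable {n : ℕ}

/-- The BHK conditioning set `{s ↮ {a₀}}` is `{a₀ ↮ s}`. [folklore] -/
theorem toolHijackBHK_notReach_eq (s a₀ : Fin n) :
    {ω : BondConfig (Fin n) | ∀ x ∈ ({a₀} : Set (Fin n)), ¬ (openGraph ω).Reachable s x} =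
      (openConn a₀ s : Set (BondConfig (Fin n)))ᶜ := by
  ext ω
  simp only [Set.mem_setOf_eq, Set.mem_singleton_iff, forall_eq, Set.mem_compl_iff]
  rw [show (ω ∈ openConn a₀ s ↔ (openGraph ω).Reachable a₀ s) from Iff.rfl]
  exact ⟨fun h h' => h h'.symm, fun h h' => h h'.symm⟩

/-- A fibre `{C(s) = T}` with `a₀ ∉ T` lies inside `{a₀ ↮ s}`. [folklore] -/
theorem toolHijackBHK_compl_inter_fib_of_notMem (s a₀ : Fin n) (T : Finset (Fin n)) (ha₀ : a₀ ∉ T) :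
    (openConn a₀ s : Set (BondConfig (Fin n)))ᶜ ∩ {ω : BondConfig (Fin n) | openCluster ω s = (T : Set (Fin n))} =
      {ω : BondConfig (Fin n) | openCluster ω s = (T : Set (Fin n))} := by
  refine Set.inter_eq_right.2 fun ω hω hω' => ?_
  exact offObs_fib_subset_compl_openConn s a₀ T ha₀ hω (SimpleGraph.Reachable.symm hω')

/-- A fibre `{C(s) = T}` with `a₀ ∈ T` misses `{a₀ ↮ s}`. [folklore] -/
theorem toolHijackBHK_compl_inter_fib_of_mem (s a₀ : Fin n) (T : Finset (Fin n)) (ha₀ : a₀ ∈ T) :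
    (openConn a₀ s : Set (BondConfig (Fin n)))ᶜ ∩ {ω : BondConfig (Fin n) | openCluster ω s = (T : Set (Fin n))} = ∅ := by
  refine Set.eq_empty_of_forall_notMem fun ω hω => ?_
  exact hω.1 (SimpleGraph.Reachable.symm (offObs_fib_subset_openConn s a₀ T ha₀ hω.2))

/-- On `{C(s) = T}` with `a₀ ∉ T`, `x ↔ a₀` iff `x ↔ a₀ in Tᶜ`: an open path from `a₀` meeting `T = C(s)` would join `a₀`
to `s`. [folklore] -/
theorem toolHijackBHK_fib_inter_openConn (s x a₀ : Fin n) (T : Finset (Fin n)) (ha₀ : a₀ ∉ T) :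
    {ω : BondConfig (Fin n) | openCluster ω s = (T : Set (Fin n))} ∩ openConn x a₀ =
      {ω : BondConfig (Fin n) | openCluster ω s = (T : Set (Fin n))} ∩ openConnIn ((T : Set (Fin n))ᶜ) x a₀ := by
  ext ω
  simp only [Set.mem_inter_iff, Set.mem_setOf_eq]
  refine ⟨fun h => ⟨h.1, ?_⟩, fun h => ⟨h.1, openConnIn_subset_openConn _ x a₀ h.2⟩⟩
  obtain ⟨hT, hxa⟩ := h
  -- every vertex joined to `a₀` lies outside `T = C(s)`
  have hout : ∀ y : Fin n, (openGraph ω).Reachable a₀ y → y ∈ ((T : Set (Fin n))ᶜ : Set (Fin n)) := by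
    intro y hy hyT
    have hsy : (openGraph ω).Reachable s y := by
      have : y ∈ openCluster ω s := by rw [hT]; exact hyT
      exact this
    exact offObs_fib_subset_compl_openConn s a₀ T ha₀ hT (hsy.trans hy.symm)
  rw [openConnIn_comm]
  apply DCT16.mem_openConnIn_of_pathIn
  have hr : (openGraph ω).Reachable a₀ x := SimpleGraph.Reachable.symm hxa
  rw [SimpleGraph.reachable_iff_reflTransGen] at hr
  refine ⟨hout a₀ (SimpleGraph.Reachable.refl a₀), ?_⟩
  clear hxa
  induction hr with
  | refl => exact Relation.ReflTransGen.refl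
  | @tail y z hay hyz ih =>
    exact ih.tail ⟨hyz, hout z ((SimpleGraph.reachable_iff_reflTransGen _ _).2 (hay.tail hyz))⟩

/-- `T ↦ μ(x ↔ a₀ in Tᶜ)` is antitone in the vertex set `T`. [folklore] -/
theorem toolHijackBHK_psi_antitone (u : Sym2 (Fin n) → unitInterval) (x a₀ : Fin n) :
    Antitone (fun T : Finset (Fin n) => (prodBernoulli u).real (openConnIn ((T : Set (Fin n))ᶜ) x a₀)) := by
  intro T T' hTT'
  refine measureReal_mono (goodStep24_openConnIn_mono ?_ x a₀) (measure_ne_top _ _)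
  exact Set.compl_subset_compl.2 (Finset.coe_subset.2 hTT')

end ToolHijackBHKAux

/-- **Tool N2 of the pair step: the hijack bound `Z(s) · Hij ≤ WIN(s) · Z_x(s)`** (registered stub `stub_toolHijackBHK`
of crux stmt-CriticalPhenomena-4576, line `peel`).  For the relay set `A ∋ b, a₀`, the observer `s ∉ A` and a bystander
`x ∉ A`, with `Z(s) = Σ_{W dead} μ(C(s) = W) · min_{a ∈ A} μ(a ↔ b in Wᶜ)` (dead: `s ∈ W`, `W ∩ A = ∅`):
`Z(s) · μ(s ↔ b, a₀ ↮ s, x ↔ a₀) ≤ μ(s ↔ b, a₀ ↮ s) · Σ_{W dead} μ(C(s) = W) · min_{a ∈ A} μ(a ↔ b in Wᶜ) · μ(x ↔ a₀ in Wᶜ)`.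
Proof: BHK 2006 eq. (2) (negative correlation of `C_s`, `C_{a₀}` given `s ↮ a₀`) and Thm 1.3 (antitone × antitone for the
cluster of `s` given `s ↮ a₀`), the cluster Markov property identifying the fibre sums, and cancellation of `μ(a₀ ↮ s)`.
[cite: VandenbergHaggstromKahn2005, eq. (2) (p. 2), Thm. 1.3 (p. 6), Thm. 1.4 (p. 7); KozmaNitzan2024, Lemma 1 (pp. 5–6), §3.2 pp. 12–14] -/
theorem stub_toolHijackBHK :
    ∀ (n : ℕ) (u : Sym2 (Fin n) → unitInterval) (A : Finset (Fin n)) (b a₀ s x : Fin n) (hb : b ∈ A),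
      a₀ ∈ A → s ∉ A → x ∉ A → s ≠ x →
      (∑ W ∈ (Finset.univ : Finset (Finset (Fin n))).filter (fun W => s ∈ W ∧ Disjoint W A),
              (prodBernoulli u).real {ω : BondConfig (Fin n) | openCluster ω s = (W : Set (Fin n))}
                * A.inf' ⟨b, hb⟩ (fun a => (prodBernoulli u).real (openConnIn ((W : Set (Fin n))ᶜ) a b)))
        * (prodBernoulli u).real (openConn s b ∩ (openConn a₀ s)ᶜ ∩ openConn x a₀)
      ≤ (prodBernoulli u).real (openConn s b ∩ (openConn a₀ s)ᶜ)
        * (∑ W ∈ (Finset.univ : Finset (Finset (Fin n))).filter (fun W => s ∈ W ∧ Disjoint W A),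
              (prodBernoulli u).real {ω : BondConfig (Fin n) | openCluster ω s = (W : Set (Fin n))}
                * A.inf' ⟨b, hb⟩ (fun a => (prodBernoulli u).real (openConnIn ((W : Set (Fin n))ᶜ) a b))
                * (prodBernoulli u).real (openConnIn ((W : Set (Fin n))ᶜ) x a₀)) := by
  intro n u A b a₀ s x hb ha₀ hs hx hsx
  have hsa₀ : s ≠ a₀ := fun h => hs (h ▸ ha₀)
  have hnn : ∀ U : Finset (Fin n), 0 ≤ A.inf' ⟨b, hb⟩
      (fun a => (prodBernoulli u).real (openConnIn ((U : Set (Fin n)))ᶜ a b)) :=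
    fun U => Finset.le_inf' _ _ fun a _ => measureReal_nonneg
  -- Step 1: BHK 2006 eq. (2) — `1{b ∈ C_s}` and `1{x ∈ C_{a₀}}` are negatively correlated given `{s ↮ a₀}`
  have hB := Literature.Probability.Percolation.BHK2006_twoClusterConditionalAssociation_holds.openConn_negCorrelation
    (Fin n) u s a₀ b x hsa₀
  rw [knThm2_openConn_comm s a₀, knThm2_openConn_comm a₀ x] at hB
  -- Step 2: BHK Thm 1.3, antitone × antitone, for the cluster of `s` given `{s ↮ a₀}`, functions `ζ` and `ψ`
  have hT := offObs_bhk_anti_anti u s ({a₀} : Set (Fin n)) (by simpa using hsa₀)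
    (fun T : Finset (Fin n) => if Disjoint T A then
      A.inf' ⟨b, hb⟩ (fun a => (prodBernoulli u).real (openConnIn ((T : Set (Fin n)))ᶜ a b)) else 0)
    (fun T : Finset (Fin n) => (prodBernoulli u).real (openConnIn ((T : Set (Fin n))ᶜ) x a₀))
    (pairStep_zeta_antitone u A b hb) (toolHijackBHK_psi_antitone u x a₀)
  rw [toolHijackBHK_notReach_eq s a₀] at hT
  -- the three fibre sums of Step 2: `Z(s)`, `μ(a₀ ↮ s, x ↔ a₀)`, `Z_x(s)`
  have hZ : ∑ T : Finset (Fin n), (if Disjoint T A then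
        A.inf' ⟨b, hb⟩ (fun a => (prodBernoulli u).real (openConnIn ((T : Set (Fin n)))ᶜ a b)) else 0) *
        (prodBernoulli u).real ((openConn a₀ s : Set (BondConfig (Fin n)))ᶜ ∩
          {ω : BondConfig (Fin n) | openCluster ω s = (T : Set (Fin n))}) =
      ∑ W ∈ (Finset.univ : Finset (Finset (Fin n))).filter (fun W => s ∈ W ∧ Disjoint W A),
        (prodBernoulli u).real {ω : BondConfig (Fin n) | openCluster ω s = (W : Set (Fin n))}
          * A.inf' ⟨b, hb⟩ (fun a => (prodBernoulli u).real (openConnIn ((W : Set (Fin n))ᶜ) a b)) := by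
    rw [Finset.sum_filter]
    refine Finset.sum_congr rfl fun T _ => ?_
    by_cases hd : Disjoint T A
    · have haT : a₀ ∉ T := fun h => Finset.disjoint_left.1 hd h ha₀
      rw [if_pos hd, toolHijackBHK_compl_inter_fib_of_notMem s a₀ T haT]
      by_cases hsT : s ∈ T
      · rw [if_pos (show s ∈ T ∧ Disjoint T A from ⟨hsT, hd⟩)]
        ring
      · rw [if_neg (show ¬ (s ∈ T ∧ Disjoint T A) from fun h => hsT h.1), offObs_fib_eq_empty s T hsT,
          measureReal_empty, mul_zero]
    · rw [if_neg hd, if_neg (show ¬ (s ∈ T ∧ Disjoint T A) from fun h => hd h.2)]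
      ring
  have hΨ : ∑ T : Finset (Fin n), (prodBernoulli u).real (openConnIn ((T : Set (Fin n))ᶜ) x a₀) *
        (prodBernoulli u).real ((openConn a₀ s : Set (BondConfig (Fin n)))ᶜ ∩
          {ω : BondConfig (Fin n) | openCluster ω s = (T : Set (Fin n))}) =
      (prodBernoulli u).real ((openConn a₀ s : Set (BondConfig (Fin n)))ᶜ ∩ openConn x a₀) := by
    rw [← offObs_sum_fib_inter u s ((openConn a₀ s : Set (BondConfig (Fin n)))ᶜ ∩ openConn x a₀)]
    refine Finset.sum_congr rfl fun T _ => ?_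
    rw [← Set.inter_assoc, Set.inter_comm {ω : BondConfig (Fin n) | openCluster ω s = (T : Set (Fin n))}
      (openConn a₀ s : Set (BondConfig (Fin n)))ᶜ]
    by_cases haT : a₀ ∈ T
    · rw [toolHijackBHK_compl_inter_fib_of_mem s a₀ T haT, Set.empty_inter, measureReal_empty, mul_zero]
    · rw [toolHijackBHK_compl_inter_fib_of_notMem s a₀ T haT]
      by_cases hsT : s ∈ T
      · rw [toolHijackBHK_fib_inter_openConn s x a₀ T haT,
          offObs_fibre_inter u s T hsT _ (offObs_determinedBy_openConnIn_compl T x a₀)]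
        ring
      · rw [offObs_fib_eq_empty s T hsT, Set.empty_inter, measureReal_empty, mul_zero]
  have hZx : ∑ T : Finset (Fin n), ((if Disjoint T A then
        A.inf' ⟨b, hb⟩ (fun a => (prodBernoulli u).real (openConnIn ((T : Set (Fin n)))ᶜ a b)) else 0) *
        (prodBernoulli u).real (openConnIn ((T : Set (Fin n))ᶜ) x a₀)) *
        (prodBernoulli u).real ((openConn a₀ s : Set (BondConfig (Fin n)))ᶜ ∩
          {ω : BondConfig (Fin n) | openCluster ω s = (T : Set (Fin n))}) =
      ∑ W ∈ (Finset.univ : Finset (Finset (Fin n))).filter (fun W => s ∈ W ∧ Disjoint W A),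
        (prodBernoulli u).real {ω : BondConfig (Fin n) | openCluster ω s = (W : Set (Fin n))}
          * A.inf' ⟨b, hb⟩ (fun a => (prodBernoulli u).real (openConnIn ((W : Set (Fin n))ᶜ) a b))
          * (prodBernoulli u).real (openConnIn ((W : Set (Fin n))ᶜ) x a₀) := by
    rw [Finset.sum_filter]
    refine Finset.sum_congr rfl fun T _ => ?_
    by_cases hd : Disjoint T A
    · have haT : a₀ ∉ T := fun h => Finset.disjoint_left.1 hd h ha₀
      rw [if_pos hd, toolHijackBHK_compl_inter_fib_of_notMem s a₀ T haT]
      by_cases hsT : s ∈ T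
      · rw [if_pos (show s ∈ T ∧ Disjoint T A from ⟨hsT, hd⟩)]
        ring
      · rw [if_neg (show ¬ (s ∈ T ∧ Disjoint T A) from fun h => hsT h.1), offObs_fib_eq_empty s T hsT,
          measureReal_empty, mul_zero]
    · rw [if_neg hd, if_neg (show ¬ (s ∈ T ∧ Disjoint T A) from fun h => hd h.2)]
      ring
  -- Step 2 in the syntax of the statement: `Z(s) · μ(a₀ ↮ s, x ↔ a₀) ≤ μ(a₀ ↮ s) · Z_x(s)`
  have key : (∑ W ∈ (Finset.univ : Finset (Finset (Fin n))).filter (fun W => s ∈ W ∧ Disjoint W A),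
        (prodBernoulli u).real {ω : BondConfig (Fin n) | openCluster ω s = (W : Set (Fin n))}
          * A.inf' ⟨b, hb⟩ (fun a => (prodBernoulli u).real (openConnIn ((W : Set (Fin n))ᶜ) a b)))
        * (prodBernoulli u).real ((openConn a₀ s : Set (BondConfig (Fin n)))ᶜ ∩ openConn x a₀) ≤
      (prodBernoulli u).real (openConn a₀ s : Set (BondConfig (Fin n)))ᶜ
        * (∑ W ∈ (Finset.univ : Finset (Finset (Fin n))).filter (fun W => s ∈ W ∧ Disjoint W A),
            (prodBernoulli u).real {ω : BondConfig (Fin n) | openCluster ω s = (W : Set (Fin n))}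
              * A.inf' ⟨b, hb⟩ (fun a => (prodBernoulli u).real (openConnIn ((W : Set (Fin n))ᶜ) a b))
              * (prodBernoulli u).real (openConnIn ((W : Set (Fin n))ᶜ) x a₀)) := by
    rw [← hZ, ← hΨ, ← hZx]
    exact hT
  -- the events of the statement in conditional form
  have hE1 : (openConn s b : Set (BondConfig (Fin n))) ∩ (openConn a₀ s)ᶜ ∩ openConn x a₀ =
      (openConn a₀ s : Set (BondConfig (Fin n)))ᶜ ∩ (openConn s b ∩ openConn x a₀) := by
    rw [Set.inter_comm (openConn s b : Set (BondConfig (Fin n))) (openConn a₀ s)ᶜ, Set.inter_assoc]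
  have hE2 : (openConn s b : Set (BondConfig (Fin n))) ∩ (openConn a₀ s)ᶜ =
      (openConn a₀ s : Set (BondConfig (Fin n)))ᶜ ∩ openConn s b := Set.inter_comm _ _
  rw [hE1, hE2]
  -- names and signs
  set d := (prodBernoulli u).real (openConn a₀ s : Set (BondConfig (Fin n)))ᶜ with hd
  set H := (prodBernoulli u).real ((openConn a₀ s : Set (BondConfig (Fin n)))ᶜ ∩ (openConn s b ∩ openConn x a₀))
    with hH
  set Sb := (prodBernoulli u).real ((openConn a₀ s : Set (BondConfig (Fin n)))ᶜ ∩ openConn s b) with hSb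
  set Xa := (prodBernoulli u).real ((openConn a₀ s : Set (BondConfig (Fin n)))ᶜ ∩ openConn x a₀) with hXa
  set Z := ∑ W ∈ (Finset.univ : Finset (Finset (Fin n))).filter (fun W => s ∈ W ∧ Disjoint W A),
      (prodBernoulli u).real {ω : BondConfig (Fin n) | openCluster ω s = (W : Set (Fin n))}
        * A.inf' ⟨b, hb⟩ (fun a => (prodBernoulli u).real (openConnIn ((W : Set (Fin n))ᶜ) a b)) with hZdef
  set Zx := ∑ W ∈ (Finset.univ : Finset (Finset (Fin n))).filter (fun W => s ∈ W ∧ Disjoint W A),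
      (prodBernoulli u).real {ω : BondConfig (Fin n) | openCluster ω s = (W : Set (Fin n))}
        * A.inf' ⟨b, hb⟩ (fun a => (prodBernoulli u).real (openConnIn ((W : Set (Fin n))ᶜ) a b))
        * (prodBernoulli u).real (openConnIn ((W : Set (Fin n))ᶜ) x a₀) with hZxdef
  have hZ0 : 0 ≤ Z := Finset.sum_nonneg fun W _ => mul_nonneg measureReal_nonneg (hnn W)
  have hZx0 : 0 ≤ Zx :=
    Finset.sum_nonneg fun W _ => mul_nonneg (mul_nonneg measureReal_nonneg (hnn W)) measureReal_nonneg
  have hSb0 : 0 ≤ Sb := measureReal_nonneg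
  have hH0 : 0 ≤ H := measureReal_nonneg
  have hHle : H ≤ d := measureReal_mono Set.inter_subset_left (measure_ne_top _ _)
  -- hB : d * H ≤ Sb * Xa ;  key : Z * Xa ≤ d * Zx
  have h1 : d * (Z * H) ≤ Z * (Sb * Xa) := by
    have := mul_le_mul_of_nonneg_left hB hZ0
    linarith
  have h2 : Z * (Sb * Xa) ≤ d * (Sb * Zx) := by
    have := mul_le_mul_of_nonneg_left key hSb0
    linarith
  by_cases hd0 : d = 0
  · have hH' : H = 0 := le_antisymm (hd0 ▸ hHle) hH0
    rw [hH', mul_zero]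
    exact mul_nonneg hSb0 hZx0
  · have hdpos : 0 < d := lt_of_le_of_ne measureReal_nonneg (Ne.symm hd0)
    exact le_of_mul_le_mul_left (h1.trans h2) hdpos

end

end Summit.CriticalPhenomena.PercolationContinuityZ3.Theorems
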